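import Summits.HodgeConjecture.HodgeConjecture.Cruxes.BlochSeedDiscOne.PhaseTorusBoxLaw
import Summits.HodgeConjecture.HodgeConjecture.Cruxes.BlochSeedDiscOne.LinePhaseTorus

/-!
# BOX LAW at DESIGN level: `μ = −32·(N₀ + i·N₁) ∈ 32ℤ[i]` for every integer (A1)-clean LINE design (control g6, 2026-08-29)

Nothing here proves HC, HC_AV, HC_CM, H2 or 18881; census-neutral; no fact, no instance, no notation.  SORRY-FREE.
Pen proof + data (41∕41 designs of record): `Cruxes/BlochSeedDiscOne/BOX-LAW-g6.md`.  Torus level: `PhaseTorusBoxLaw.lean`.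

THE STATIC DICTIONARY (the flow-free half of `lineTwoTermUp_mu_eq_zero_of_law`, steps (3)–(4)): the residual phase measure of an
integer design `ω_D(τ) = Σ_N m_N V(N)[τ(N) = τ] − Σ_P m_P V(P)[τ(P) = τ]` (`V = ∏_f c_f`, ANY integer multiplicities, no sign, no
flow, no Hall, no orbit-constancy) has torus moments = the design moments (`omegaD_moment`), hence (A1) on the LINE ⇒ clean
(`omegaD_clean`), and top moment `μ = wch(eeee)` (`omegaD_top`).  With `PhaseTorus.moment_one_eq_boxSums`:
* `lineDesign_mu_eq_boxCounts` — `C.wch mN mP eWord = ⟨−32·N₀, −32·N₁⟩`, `N₀, N₁` the signed volume-weighted counts of FC cells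
  whose phase vector lies in the boxes `{0,1}⁴`, `e₀ + {0,1}⁴`;
* `lineDesign_mu_dvd` — `32 ∣ re μ ∧ 32 ∣ im μ`;  `lineDesign_norm_mu_ge` — `μ ≠ 0 ⇒ |μ|² ≥ 1024`;
* `lineTwoTermUp10_mu_eq_zero` — the UP law at corank ≤ 10, the hypothesis `hPT` of `lineTwoTermUp_mu_eq_zero_of_law`
  DISCHARGED by `PhaseTorus.phaseTorusLawN_ten`.
-/

namespace Summit.HodgeConjecture.HodgeConjecture.Cruxes.BlochSeedDiscOne.LinePhaseTorus

open Finset BigOperators Summit.Ventures.HSemireg Summit.Ventures.HSemireg.Pad4Tower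

/-- the volume `V(Z) = ∏_f c_f` of a LINE cell. -/
def vol (h : ℤ) (Z : MCell) : ℤ := ∏ f, lineCharge h Z f

/-- the STATIC residual phase measure of an integer design. -/
def omegaD (h : ℤ) (C : MConfig) (mN mP : MCell → ℤ) (τ : Fin 4 → ZMod 4) : ℤ :=
  (∑ Z ∈ C.lower, if tau Z = τ then mN Z * vol h Z else 0) - ∑ P ∈ C.upper, if tau P = τ then mP P * vol h P else 0

/-- signed, volume-weighted count of the design's cells whose phase vector lies in the box with corner `s`. -/
def boxCount (h : ℤ) (C : MConfig) (mN mP : MCell → ℤ) (s : Fin 4 → ZMod 4) : ℤ :=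
  ∑ τ ∈ PhaseTorus.pbox s, omegaD h C mN mP τ

/-- **dictionary**: the torus moments of `ω_D` are the design moments (any integer multiplicities). -/
theorem omegaD_moment (h : ℤ) (C : MConfig) (mN mP : MCell → ℤ) (hline : ∀ Z ∈ C.lower ∪ C.upper, LineCell h Z)
    (k : Fin 4 → ZMod 4) (hk : ∀ f, k f ≠ 2) :
    PhaseTorus.moment (fun τ => ((omegaD h C mN mP τ : ℤ) : ℝ)) k =
      ((moment h C mN mP (wordOf k) : GaussianInt) : ℂ) := by
  classical
  have hL : ∀ Z ∈ C.lower, LineCell h Z := fun Z hZ => hline Z (Finset.mem_union_left _ hZ)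
  have hU : ∀ P ∈ C.upper, LineCell h P := fun P hP => hline P (Finset.mem_union_right _ hP)
  set χ : (Fin 4 → ZMod 4) → ℂ := fun τ => Complex.I ^ (∑ f, k f * τ f).val with hχ
  have hlhs : PhaseTorus.moment (fun τ => ((omegaD h C mN mP τ : ℤ) : ℝ)) k =
      ∑ Z ∈ C.lower, ((mN Z * vol h Z : ℤ) : ℂ) * χ (tau Z) -
        ∑ P ∈ C.upper, ((mP P * vol h P : ℤ) : ℂ) * χ (tau P) := by
    unfold PhaseTorus.moment PhaseTorus.chi
    have e1 : ∀ τ, ((((omegaD h C mN mP τ : ℤ) : ℝ)) : ℂ) * χ τ =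
        ∑ Z ∈ C.lower, (if tau Z = τ then ((mN Z * vol h Z : ℤ) : ℂ) * χ τ else 0) -
          ∑ P ∈ C.upper, (if tau P = τ then ((mP P * vol h P : ℤ) : ℂ) * χ τ else 0) := by
      intro τ
      unfold omegaD
      push_cast
      rw [sub_mul, Finset.sum_mul, Finset.sum_mul]
      congr 1 <;> refine Finset.sum_congr rfl fun x _ => ?_ <;> split_ifs <;> simp
    rw [Finset.sum_congr rfl fun τ _ => e1 τ, Finset.sum_sub_distrib, Finset.sum_comm,
      Finset.sum_comm (s := Finset.univ) (t := C.upper)]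
    congr 1 <;> refine Finset.sum_congr rfl fun x _ => ?_ <;> rw [Finset.sum_ite_eq] <;> simp
  have hg : ∀ Z, LineCell h Z → ((MCell.mono h Z (wordOf k) : GaussianInt) : ℂ) = (vol h Z : ℂ) * χ (tau Z) :=
    fun Z hZ => toComplex_mono_wordOf hZ k hk
  have hrhs : ((moment h C mN mP (wordOf k) : GaussianInt) : ℂ) =
      (∑ Z ∈ C.lower, (mN Z : ℂ) * ((vol h Z : ℂ) * χ (tau Z))) -
        ∑ P ∈ C.upper, (mP P : ℂ) * ((vol h P : ℂ) * χ (tau P)) := by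
    unfold moment
    rw [map_sub, map_sum, map_sum]
    congr 1
    · refine Finset.sum_congr rfl fun Z hZ => ?_
      rw [zsmul_eq_mul, map_mul, map_intCast, hg Z (hL Z hZ)]
    · refine Finset.sum_congr rfl fun P hP => ?_
      rw [zsmul_eq_mul, map_mul, map_intCast, hg P (hU P hP)]
  rw [hlhs, hrhs]
  congr 1 <;> refine Finset.sum_congr rfl fun x _ => ?_ <;> push_cast <;> ring

/-- **(A1) on the LINE ⇒ `ω_D` is clean** (via (M) `topMoment_eq_zero_of_classScreen`). -/
theorem omegaD_clean (h : ℤ) (C : MConfig) (mN mP : MCell → ℤ) (hline : ∀ Z ∈ C.lower ∪ C.upper, LineCell h Z)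
    (hA1 : ClassScreen (C.wch mN mP)) (k : Fin 4 → ZMod 4) (hk : PhaseTorus.KAdm k) :
    PhaseTorus.moment (fun τ => ((omegaD h C mN mP τ : ℤ) : ℝ)) k = 0 := by
  obtain ⟨hk2, hk1, hk3⟩ := hk
  rw [omegaD_moment h C mN mP hline k hk2, topMoment_eq_zero_of_classScreen h C mN mP hline hA1 (wordOf k)
    (wordOf_top hk2) (wordOf_ne hk2 (Or.inl ⟨rfl, rfl⟩) hk1) (wordOf_ne hk2 (Or.inr ⟨rfl, rfl⟩) hk3), map_zero]

/-- **the top torus moment of `ω_D` is `μ = wch(eeee)`**. -/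
theorem omegaD_top (h : ℤ) (C : MConfig) (mN mP : MCell → ℤ) (hline : ∀ Z ∈ C.lower ∪ C.upper, LineCell h Z) :
    PhaseTorus.moment (fun τ => ((omegaD h C mN mP τ : ℤ) : ℝ)) (fun _ => 1) =
      ((C.wch mN mP eWord : GaussianInt) : ℂ) := by
  rw [omegaD_moment h C mN mP hline (fun _ => 1) (fun _ => by decide), wordOf_one, wch_eWord_eq_moment_beta h]

/-- **BOX LAW for LINE designs**: `μ = −32·(N₀ + i·N₁)` for every integer (A1)-clean LINE design. -/
theorem lineDesign_mu_eq_boxCounts (h : ℤ) (C : MConfig) (mN mP : MCell → ℤ)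
    (hline : ∀ Z ∈ C.lower ∪ C.upper, LineCell h Z) (hA1 : ClassScreen (C.wch mN mP)) :
    C.wch mN mP eWord = ⟨-32 * boxCount h C mN mP 0, -32 * boxCount h C mN mP (Pi.single 0 1)⟩ := by
  have hK : ∀ k, PhaseTorus.KAdm k → PhaseTorus.moment (fun τ => ((omegaD h C mN mP τ : ℤ) : ℝ)) k = 0 :=
    fun k hk => omegaD_clean h C mN mP hline hA1 k hk
  have hμ := PhaseTorus.moment_one_eq_boxSums (fun τ => ((omegaD h C mN mP τ : ℤ) : ℝ)) hK
  rw [omegaD_top h C mN mP hline, PhaseTorus.boxSum_intCast, PhaseTorus.boxSum_intCast] at hμ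
  apply GaussianInt.toComplex_injective
  rw [hμ, GaussianInt.toComplex_def']
  unfold boxCount
  push_cast
  ring

/-- **`μ ∈ 32ℤ[i]`** for every integer (A1)-clean LINE design (any height, support, multiplicities, signs). -/
theorem lineDesign_mu_dvd (h : ℤ) (C : MConfig) (mN mP : MCell → ℤ)
    (hline : ∀ Z ∈ C.lower ∪ C.upper, LineCell h Z) (hA1 : ClassScreen (C.wch mN mP)) :
    (32 : ℤ) ∣ (C.wch mN mP eWord).re ∧ (32 : ℤ) ∣ (C.wch mN mP eWord).im := by
  rw [lineDesign_mu_eq_boxCounts h C mN mP hline hA1]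
  refine ⟨⟨-boxCount h C mN mP 0, ?_⟩, ⟨-boxCount h C mN mP (Pi.single 0 1), ?_⟩⟩
  · show -32 * boxCount h C mN mP 0 = 32 * -boxCount h C mN mP 0
    ring
  · show -32 * boxCount h C mN mP (Pi.single 0 1) = 32 * -boxCount h C mN mP (Pi.single 0 1)
    ring

/-- **the gap**: `μ ≠ 0 ⇒ |μ|² ≥ 1024` (so `|μ| = 32`, attained by h16-a's MINMU-A∕B, is the global floor on LINE alphabets). -/
theorem lineDesign_norm_mu_ge (h : ℤ) (C : MConfig) (mN mP : MCell → ℤ)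
    (hline : ∀ Z ∈ C.lower ∪ C.upper, LineCell h Z) (hA1 : ClassScreen (C.wch mN mP))
    (hμ : C.wch mN mP eWord ≠ 0) : 1024 ≤ (C.wch mN mP eWord).norm := by
  have hbox := lineDesign_mu_eq_boxCounts h C mN mP hline hA1
  rw [hbox] at hμ ⊢
  have hne : boxCount h C mN mP 0 ≠ 0 ∨ boxCount h C mN mP (Pi.single 0 1) ≠ 0 := by
    by_contra hc
    push_neg at hc
    apply hμ
    rw [hc.1, hc.2]
    rfl
  rw [Zsqrtd.norm_def]
  show (1024 : ℤ) ≤ -32 * boxCount h C mN mP 0 * (-32 * boxCount h C mN mP 0) -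
      -1 * (-32 * boxCount h C mN mP (Pi.single 0 1)) * (-32 * boxCount h C mN mP (Pi.single 0 1))
  rcases hne with ha | hb
  · have := Int.one_le_abs ha
    nlinarith [sq_abs (boxCount h C mN mP 0), sq_nonneg (boxCount h C mN mP (Pi.single 0 1)),
      abs_nonneg (boxCount h C mN mP 0)]
  · have := Int.one_le_abs hb
    nlinarith [sq_abs (boxCount h C mN mP (Pi.single 0 1)), sq_nonneg (boxCount h C mN mP 0),
      abs_nonneg (boxCount h C mN mP (Pi.single 0 1))]

/-- **the UP law at corank ≤ 10, UNCONDITIONAL**: `lineTwoTermUp_mu_eq_zero_of_law 10` with `hPT` discharged by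
`PhaseTorus.phaseTorusLawN_ten` (box law + double counting). -/
theorem lineTwoTermUp10_mu_eq_zero (h : ℤ) (C : MConfig) (mN mP : MCell → ℤ)
    (hmN : ∀ Z, 0 ≤ mN Z) (hmP : ∀ P, 0 ≤ mP P)
    (hline : ∀ Z ∈ C.lower ∪ C.upper, LineCell h Z) (hA1 : ClassScreen (C.wch mN mP))
    (F : UpFlow C mN mP) (hrank : (∑ Z ∈ C.lower, mN Z) - (∑ P ∈ C.upper, mP P) ≤ 10) :
    C.wch mN mP eWord = 0 :=
  lineTwoTermUp_mu_eq_zero_of_law 10 (fun ω A hA hω hK => PhaseTorus.phaseTorusLawN_ten ω A hA hω hK)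
    h C mN mP hmN hmP hline hA1 F (by exact_mod_cast hrank)

end Summit.HodgeConjecture.HodgeConjecture.Cruxes.BlochSeedDiscOne.LinePhaseTorus
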